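import Literature.NumberTheory.LFunctions.Zhang2022.Section3PhiStar
import Literature.NumberTheory.LFunctions.Zhang2022.Section3Lemma32Flat
import HarnessLib

/-!
# Zhang (2022) §3, the PRINTED Lemma 3.2 made conditional on its `L`-size input:
# `∑_{D⁴ < n ≤ D⁸} ν(n)² τ₂(n)²/n ≪ 𝓛^{-2007}` under (A), GIVEN a bound
# `‖L(¾+it,χ)‖ ≤ C_L D^κ (1+|t|)^b` with `κ < 1/8` — kernel-checked

Topic `Literature/NumberTheory/LFunctions/Zhang2022` (Landau–Siegel autopsy tree; verdict-neutral).
Y. Zhang, *Discrete mean estimates and the Landau–Siegel zero*, arXiv:2211.02515v1 — **an unrefereed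
manuscript, a claimed result under adjudication** (audit + repair census of arXiv:2211.02515; no claim
about Landau–Siegel is made here) — §3, Lemma 3.2 [p. 7]:

  *Lemma 3.2. Assume (A) holds. Then `∑_{D⁴<n≤D⁸} ν(n)²τ₂(n)²/n ≪ 𝓛^{-2007}`.*
  *Proof. As the situation is analogous to Lemma 3.1 we give a sketch only. It can be verified that
  the function `φ*(s) = ζ(s)^{-8}L(s,χ)^{-8} ∑ ν(n)²τ₂(n)² n^{-s}` is analytic for `σ > 1/2` and it
  satisfies `φ*(s) ≪ ∏_{p∣D}|1 − p^{-4s}|` for `σ ≥ σ₁ > 1/2` … Also, one can verify that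
  `∫_{|s|=α*} φ*(1+s)ζ(1+s)⁸L(1+s,χ)⁸(D^{8s} − D^{4s})Γ(s) ds ≪ 𝓛^{-2007}`. This completes the proof.*

The first sentence of the sketch is the tree's `Section3PhiStar.lean` (`PhiStar.LSeries_nu_sq_tau_sq_eq`,
`PhiStar.differentiableOn_phiStar`, `PhiStar.norm_phiStar_le`). The second sentence hides the one
step of the manuscript that consumes a bound for the SIZE of `L(s,χ)` below the convexity /
Pólya–Vinogradov strength (the autopsy cell's flag F7, repair-census row V17, constraint rows
I-L3.2b / T-F7 / T-ALT1b): moving the line of integration from `re s = 1` (here `re z = 2`,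
`s = 1 + z`) to the left of `z = 0` must produce a NEGATIVE power of `D`, and on `re z = −1/4` the
integrand carries `|D^{4z}| = D^{-1}` against EIGHT factors `L(¾+it,χ)`: with
`‖L(¾+it,χ)‖ ≤ C_L D^{κ}(1+|t|)^{b}` the line is `O(D^{8κ−1+o(1)})`, a saving iff `κ < 1/8`
(in the bookkeeping `Saves k a μ := 2kμ < a` of `Section3SubconvexInput.lean`, with `κ = μ/2` the
Phragmén–Lindelöf interpolant at `σ = ¾` of an exponent `μ` at `σ = ½`: `Saves 8 4 μ ↔ μ < ¼`,
`saves_lemma32_iff`). Convexity / Pólya–Vinogradov give exactly `κ = 1/8` (times a logarithm) — the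
boundary case, NOT covered (`not_saves_lemma32_convexity`); Burgess
[IwaniecKowalski2004, Thm 12.9; Burgess1963CharacterSumsII] gives `μ = 3/16 + ε`, i.e. `κ = 3/32 + ε`;
Weyl strength [PetrowYoung2023, Thm 1.1; ConreyIwaniec2000 for real `χ`] gives `κ = 1/12 + ε`; the
hybrid bounds of Heath-Brown give the `(1+|t|)^{b}` shape with the same `D`-exponents. None of these
is a theorem of Mathlib or of this tree, and none is asserted here: the input enters as the
HYPOTHESIS `LBound χ κ b C_L` (a binder, never an axiom), exactly as (A) does.

This file PROVES (`lemma_3_2_conditional`): for every `κ < 1/8`, `b : ℕ`, `C_L ≥ 0` there is a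
constant `C = C(κ, b, C_L)` such that for every `D` with `log D ≥ 3`, every primitive `χ` mod `D`
with `χ² = 1` satisfying (A) `‖L(1,χ)‖ ≤ 𝓛^{-2022}` AND `LBound χ κ b C_L`, and every `N ≤ D⁸`,
`∑_{D⁴ < n ≤ N} |ν(n)|² d(n)²/n ≤ C 𝓛^{-2007}` — the printed Lemma 3.2 with the printed exponent,
by the printed method, line by line as in the tree's four-factor `Section3Lemma32Flat.lean`
(the cell's Lemma 3.2♭, which needs no such input): smoothing `1_{(D⁴,D⁸]} ≤ 6(e^{-n/D⁸} − e^{-n/D⁴})`,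
Mellin on `re z = 2`, shift to `re z = −1/4` across the pole of ORDER EIGHT at `z = 0` by the tree's
strip theorem `Literature.Analysis.Complex.integral_vertical_sub_eq_sum_of_poles` (residue
`h⁽⁷⁾(0)/7!`, `h = ζ₁(1+z)⁸Γ(z+1)ε(z)L(1+z,χ)⁸φ*(1+z)`), Cauchy's estimate on `r = 𝓛^{-2024}` where
`‖L(1+z,χ)‖ ≤ (1+4e^{9/2})𝓛^{-2022}` by (A), `‖φ*(1+z)‖ ≤ e^{7659 P}`, `‖ε(z)‖ ≤ 24𝓛`: the residue
term is `O(𝓛 · 𝓛^{-8·2022} · 𝓛^{7·2024}) = O(𝓛^{-2007})` (`1 − 16176 + 14168 = −2007`, the printed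
count, cf. `Section3SubconvexInput.residueExp_lemma32`); on `re z = −1/4` the `D`-dependence is
`C_L⁸ D^{8κ} · d(D)⁶ · D^{-1}` (`‖φ*‖ ≤ 64^{ω(D)}e^{7659P}`, `64^{ω(D)} ≤ d(D)⁶`, `d(D) ≤ C_δ D^{δ}`
with `δ = (1−8κ)/12`) `= O(D^{-(1−8κ)/2}) = O_κ(𝓛^{-2007})`.
WHAT THIS SAYS FOR THE CELL: row T-ALT1b ("the printed route of Lemma 3.2 holds GIVEN a
`q`-aspect subconvex bound, `16μ < 4`") is now kernel-grade in the form "GIVEN `LBound` with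
`κ < 1/8`"; the complementary facts — that the consumer Lemma 3.6 does not need Lemma 3.2 at all
(A11: `Section3SigmaSplitting`, `Section3Lemma32Flat`, `Section3Lemma36Input`) and that the cell's
verdict (gap at (8.24), `Section8Certificate.not_ineq824`) is independent of §3 — are unchanged.
No statement about the manuscript's Theorems 1–2 is made or implied.

## References

* Y. Zhang, arXiv:2211.02515 (2022), §3, Lemma 3.2. [cite: Zhang2022LandauSiegel, §3, Lemma 3.2]
* H. Iwaniec, E. Kowalski, *Analytic Number Theory* (2004), Thm 12.9 (Burgess). [cite: IwaniecKowalski2004, Thm 12.9]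
-/

noncomputable section

open Complex Filter Topology Set MeasureTheory Real Metric
open scoped LSeries.notation

namespace Literature.NumberTheory.LFunctions.Zhang2022.Lemma32Cond

open Literature.NumberTheory.LFunctions.DivisorSumCharSq (eps eps_of_ne_zero eps_zero
  differentiable_eps W W_eq_tsum integral_Gamma_cpow_LSeries_eq integrable_Gamma_cpow_LSeries
  MX rpow_le_rpow_add Zconst Zconst_nonneg norm_LFunction_one_add_le)
open Literature.NumberTheory.LFunctions.Zhang2022.Lemma31 (W_ofReal summable_mul_exp_div
  one_sixth_le_exp_sub_exp norm_LFunction_le_near_one norm_LFunction_one_add_sub_le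
  ne_one_of_isPrimitive divisorSumChar_im_eq_zero eight_lt_exp_three)
open Literature.NumberTheory.LFunctions.Zhang2022.PhiFlat (re_natCast_cpow_neg_nonneg)
open Literature.NumberTheory.LFunctions.Zhang2022.PhiStar (phiStar differentiableOn_phiStar
  norm_phiStar_le norm_phiStar_le_of_re_cpow_nonneg LSeries_nu_sq_tau_sq_eq)
open Literature.NumberTheory.LFunctions.Zhang2022.Lemma32Flat (Psum Psum_nonneg aux_AB
  norm_eps_le_small)
open Literature.NumberTheory.LFunctions.ZetaM4 (CΓ CΓ_pos norm_Gamma_strip_le pow_mul_exp_le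
  integrable_pow_mul_exp integral_pow_mul_exp_le exists_pow_mul_exp_le)

variable {D : ℕ} [NeZero D] (χ : DirichletCharacter ℂ D)

/-! ### §1. The objects -/

/-- The coefficients `f(n) = ν(n)² d(n)²` (`τ₂ = d`, the number of divisors). [folklore] -/
def coeff8 (n : ℕ) : ℂ := divisorSumChar χ n ^ 2 * (n.divisors.card : ℂ) ^ 2

/-- `g(z) = L(1+z, χ)⁸ φ*(1+z)`. [folklore] -/
def gF8 (z : ℂ) : ℂ := χ.LFunction (1 + z) ^ 8 * phiStar χ (1 + z)

variable (A B : ℝ)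

/-- The regularised numerator `h(z) = ζ₁(1+z)⁸ Γ(z+1) ε(z) g(z)` (holomorphic on `re z > −1/2`).
[folklore] -/
def hnum8 (z : ℂ) : ℂ :=
  riemannZeta₁ (1 + z) ^ 8 * Complex.Gamma (z + 1) * eps A B z * gF8 χ z

/-- The integrand `F(z) = ζ(1+z)⁸ Γ(z) (B^z − A^z) g(z)`. [folklore] -/
def Fint8 (z : ℂ) : ℂ :=
  riemannZeta (1 + z) ^ 8 * Complex.Gamma z * ((B : ℂ) ^ z - (A : ℂ) ^ z) * gF8 χ z

variable {A B}

/-- Off `z = 0` (and off the poles of `Γ`), `F(z) = h(z)/z⁸`. [folklore] -/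
theorem Fint8_eq_hnum8_div {z : ℂ} (hz : z ≠ 0) (hz' : ∀ m : ℕ, z ≠ -(m : ℂ)) :
    Fint8 χ A B z = hnum8 χ A B z / (z - 0) ^ (7 + 1) := by
  have h1 : (1 : ℂ) + z ≠ 1 := by intro h; exact hz (by linear_combination h)
  rw [Fint8, hnum8, LFunctions.riemannZeta₁_eq_mul h1, Complex.Gamma_add_one _ hz,
    eps_of_ne_zero _ _ hz, sub_zero, add_sub_cancel_left]
  have := hz' 0
  field_simp
  ring

/-- `∑ f(n) n^{-(1+z)} = ζ(1+z)⁸ g(z)` for `re z > 0` (`χ² = 1`). [folklore] -/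
theorem LSeries_coeff8_one_add (hχ : χ ^ 2 = 1) {z : ℂ} (hz : 0 < z.re) :
    L (coeff8 χ) (1 + z) = riemannZeta (1 + z) ^ 8 * gF8 χ z := by
  have h1 : 1 < (1 + z).re := by simp; linarith
  have := LSeries_nu_sq_tau_sq_eq χ hχ h1
  show L (fun n => divisorSumChar χ n ^ 2 * (n.divisors.card : ℂ) ^ 2) (1 + z) = _
  rw [this, gF8, DirichletCharacter.LFunction_eq_LSeries χ h1]
  ring

/-- `g` is differentiable on `re z > −1/2` (`χ` non-trivial, `χ² = 1`). [folklore] -/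
theorem differentiableOn_gF8 (hχ : χ ^ 2 = 1) (hχ1 : χ ≠ 1) :
    DifferentiableOn ℂ (gF8 χ) {z : ℂ | -(1 / 2) < z.re} := by
  intro z hz
  have hz' : -(1 / 2) < z.re := hz
  have h1 : DifferentiableAt ℂ (fun z : ℂ => (1 : ℂ) + z) z := differentiableAt_id.const_add _
  have hL : DifferentiableAt ℂ (fun z : ℂ => χ.LFunction (1 + z) ^ 8) z :=
    ((DirichletCharacter.differentiable_LFunction hχ1).differentiableAt.comp z h1).pow 8
  have hopen : IsOpen {s : ℂ | 1 / 2 < s.re} := isOpen_lt continuous_const Complex.continuous_re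
  have hφ : DifferentiableAt ℂ (phiStar χ) (1 + z) :=
    (differentiableOn_phiStar χ hχ).differentiableAt (hopen.mem_nhds (by simp; linarith))
  exact (hL.mul (hφ.comp z h1)).differentiableWithinAt

/-- `h` is differentiable on `re z > −1/2`. [folklore] -/
theorem differentiableOn_hnum8 (hχ : χ ^ 2 = 1) (hχ1 : χ ≠ 1) (hA : 0 < A) (hB : 0 < B) :
    DifferentiableOn ℂ (hnum8 χ A B) {z : ℂ | -(1 / 2) < z.re} := by
  intro z hz
  have hz' : -(1 / 2) < z.re := hz
  refine DifferentiableWithinAt.mul ?_ (differentiableOn_gF8 χ hχ hχ1 z hz)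
  refine DifferentiableAt.differentiableWithinAt ?_
  refine DifferentiableAt.mul (DifferentiableAt.mul ?_ ?_) ((differentiable_eps hA hB) z)
  · exact ((differentiable_riemannZeta₁.comp
      ((differentiable_const (1 : ℂ)).add differentiable_id)) z).pow 8
  · refine (Complex.differentiableAt_Gamma _ fun m hm => ?_).comp z (differentiableAt_id.add_const 1)
    have := congrArg Complex.re hm
    simp at this
    have h0 : (0 : ℝ) ≤ m := Nat.cast_nonneg m
    linarith

/-- `F` is differentiable on `re z > −1/2` away from `z = 0`. [folklore] -/
theorem differentiableOn_Fint8 (hχ : χ ^ 2 = 1) (hχ1 : χ ≠ 1) (hA : 0 < A) (hB : 0 < B) :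
    DifferentiableOn ℂ (Fint8 χ A B) ({z : ℂ | -(1 / 2) < z.re} \ {0}) := by
  intro z hz
  have hz1 : -(1 / 2) < z.re := hz.1
  have hz0 : z ≠ 0 := hz.2
  refine DifferentiableWithinAt.mul ?_ ((differentiableOn_gF8 χ hχ hχ1 z hz.1).mono fun x hx => hx.1)
  refine DifferentiableAt.differentiableWithinAt ?_
  refine DifferentiableAt.mul (DifferentiableAt.mul ?_ ?_) ?_
  · have h1 : (1 : ℂ) + z ≠ 1 := by intro h; exact hz0 (by linear_combination h)
    exact ((differentiableAt_riemannZeta h1).comp z (differentiableAt_id.const_add _)).pow 8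
  · refine Complex.differentiableAt_Gamma _ fun m hm => ?_
    rcases Nat.eq_zero_or_pos m with rfl | hm0
    · exact hz0 (by simpa using hm)
    · have := congrArg Complex.re hm
      simp at this
      have h1 : (1 : ℝ) ≤ m := by exact_mod_cast hm0
      linarith
  · exact (differentiableAt_id.const_cpow (Or.inl (ofReal_ne_zero.2 hB.ne'))).sub
      (differentiableAt_id.const_cpow (Or.inl (ofReal_ne_zero.2 hA.ne')))

/-! ### §2. The line `re z = 2`: Mellin -/

omit [NeZero D] in
/-- `|f(n)| ≤ C n` (`|ν(n)|² d(n)² ≤ d(n)⁴ ≤ (C₀ n^{1/4})⁴`). [folklore] -/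
theorem exists_norm_coeff8_le : ∃ C : ℝ, ∀ n : ℕ, ‖coeff8 χ n‖ ≤ C * n := by
  obtain ⟨C₀, hC₀, h⟩ := Sieve.exists_card_divisors_le_mul_rpow (by norm_num : (0 : ℝ) < 1 / 4)
  refine ⟨C₀ ^ 4, fun n => ?_⟩
  rcases eq_or_ne n 0 with rfl | hn
  · simp [coeff8]
  have hτ := h n hn
  have hν : ‖divisorSumChar χ n‖ ≤ C₀ * (n : ℝ) ^ (1 / 4 : ℝ) := (norm_divisorSumChar_le χ n).trans hτ
  have h0 : 0 ≤ ‖divisorSumChar χ n‖ := norm_nonneg _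
  have hn' : (0 : ℝ) < n := by positivity
  rw [coeff8, norm_mul, norm_pow, norm_pow, Complex.norm_natCast]
  calc ‖divisorSumChar χ n‖ ^ 2 * (n.divisors.card : ℝ) ^ 2
      ≤ (C₀ * (n : ℝ) ^ (1 / 4 : ℝ)) ^ 2 * (C₀ * (n : ℝ) ^ (1 / 4 : ℝ)) ^ 2 := by gcongr
    _ = C₀ ^ 4 * ((n : ℝ) ^ (1 / 4 : ℝ)) ^ 4 := by ring
    _ = C₀ ^ 4 * n := by
        rw [← Real.rpow_natCast ((n : ℝ) ^ (1 / 4 : ℝ)) 4, ← Real.rpow_mul hn'.le]; norm_num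

/-- On `re z = 2`: `F(2+iy) = Γ B^{z} L(f,1+z) − Γ A^{z} L(f,1+z)`. [folklore] -/
theorem Fint8_line_two (hχ : χ ^ 2 = 1) (y : ℝ) :
    Fint8 χ A B (2 + y * I) =
      Complex.Gamma (2 + y * I) * (B : ℂ) ^ (2 + y * I : ℂ) * L (coeff8 χ) (1 + (2 + y * I)) -
      Complex.Gamma (2 + y * I) * (A : ℂ) ^ (2 + y * I : ℂ) * L (coeff8 χ) (1 + (2 + y * I)) := by
  have hre : 0 < (2 + y * I : ℂ).re := by simp
  rw [Fint8, LSeries_coeff8_one_add χ hχ hre]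
  ring

/-- **Mellin on `re z = 2`**: integrability and
`∫ F(2+iy) dy = 2π (W_f(B) − W_f(A))`. [folklore] -/
theorem integral_Fint8_line_two (hχ : χ ^ 2 = 1) (hA : 0 < A) (hB : 0 < B) :
    Integrable (fun y : ℝ => Fint8 χ A B (2 + y * I)) ∧
    ∫ y : ℝ, Fint8 χ A B (2 + y * I) = 2 * π * (W (coeff8 χ) B - W (coeff8 χ) A) := by
  obtain ⟨C, hC⟩ := exists_norm_coeff8_le χ
  have I₁ := integrable_Gamma_cpow_LSeries hC hB
  have I₂ := integrable_Gamma_cpow_LSeries hC hA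
  have hfun : (fun y : ℝ => Fint8 χ A B (2 + y * I)) = fun y : ℝ =>
      Complex.Gamma (2 + y * I) * (B : ℂ) ^ (2 + y * I : ℂ) * L (coeff8 χ) (1 + (2 + y * I)) -
      Complex.Gamma (2 + y * I) * (A : ℂ) ^ (2 + y * I : ℂ) * L (coeff8 χ) (1 + (2 + y * I)) :=
    funext fun y => Fint8_line_two χ hχ y
  rw [hfun]
  have I12 : Integrable fun y : ℝ =>
      Complex.Gamma (2 + y * I) * (B : ℂ) ^ (2 + y * I : ℂ) * L (coeff8 χ) (1 + (2 + y * I)) -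
      Complex.Gamma (2 + y * I) * (A : ℂ) ^ (2 + y * I : ℂ) * L (coeff8 χ) (1 + (2 + y * I)) :=
    I₁.sub I₂
  refine ⟨I12, ?_⟩
  rw [integral_sub I₁ I₂, integral_Gamma_cpow_LSeries_eq hC hB, integral_Gamma_cpow_LSeries_eq hC hA]
  ring

/-! ### §3. The smoothed sums are real; the smoothing step -/

omit [NeZero D] in
/-- `f(n) = ν(n)²d(n)²` is the real number `|ν(n)|² d(n)²` (`χ² = 1`). [folklore] -/
theorem coeff8_eq_ofReal (hχ : χ ^ 2 = 1) (n : ℕ) :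
    coeff8 χ n = ((‖divisorSumChar χ n‖ ^ 2 * (n.divisors.card : ℝ) ^ 2 : ℝ) : ℂ) := by
  rw [coeff8, Lemma31.divisorSumChar_sq_eq χ hχ n]
  push_cast
  ring

omit [NeZero D] in
/-- `W_f(Y)` as a real series. [folklore] -/
theorem W_coeff8_eq (hχ : χ ^ 2 = 1) (Y : ℝ) :
    W (coeff8 χ) Y = ((∑' n : ℕ, ‖divisorSumChar χ n‖ ^ 2 * (n.divisors.card : ℝ) ^ 2 *
      Real.exp (-(n / Y)) / n : ℝ) : ℂ) := by
  have : coeff8 χ = fun n => ((‖divisorSumChar χ n‖ ^ 2 * (n.divisors.card : ℝ) ^ 2 : ℝ) : ℂ) :=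
    funext (coeff8_eq_ofReal χ hχ)
  rw [this, W_ofReal]

omit [NeZero D] in
/-- Summability of the real series for `Y > 0`. [folklore] -/
theorem summable_coeff8_real {Y : ℝ} (hY : 0 < Y) :
    Summable fun n : ℕ => ‖divisorSumChar χ n‖ ^ 2 * (n.divisors.card : ℝ) ^ 2 *
      Real.exp (-(n / Y)) / n := by
  obtain ⟨C, hC⟩ := exists_norm_coeff8_le χ
  refine summable_mul_exp_div (C := C) (fun n => ?_) hY
  rw [abs_of_nonneg (by positivity)]
  have := hC n
  rwa [coeff8, norm_mul, norm_pow, norm_pow, Complex.norm_natCast] at this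

omit [NeZero D] in
/-- **The smoothing step**: for `0 < A ≤ M`, `4A ≤ B`, `N ≤ B`,
`∑_{M < n ≤ N} |ν(n)|²d(n)²/n ≤ 6 · re (W_f(B) − W_f(A))`. [folklore] -/
theorem sum_Ioc_tau_sq_le (hχ : χ ^ 2 = 1) (hA : 0 < A) (hAB : 4 * A ≤ B) {M N : ℕ}
    (hM : A ≤ M) (hN : (N : ℝ) ≤ B) :
    ∑ n ∈ Finset.Ioc M N, ‖divisorSumChar χ n‖ ^ 2 * (n.divisors.card : ℝ) ^ 2 / n ≤
      6 * (W (coeff8 χ) B - W (coeff8 χ) A).re := by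
  have hB : 0 < B := by linarith
  set a : ℕ → ℝ := fun n => ‖divisorSumChar χ n‖ ^ 2 * (n.divisors.card : ℝ) ^ 2 *
    (Real.exp (-(n / B)) - Real.exp (-(n / A))) / n with ha
  have hsB := summable_coeff8_real χ hB
  have hsA := summable_coeff8_real χ hA
  have hre : (W (coeff8 χ) B - W (coeff8 χ) A).re = ∑' n, a n := by
    rw [W_coeff8_eq χ hχ, W_coeff8_eq χ hχ, ← ofReal_sub, ofReal_re, ← hsB.tsum_sub hsA]
    refine tsum_congr fun n => ?_
    simp only [ha]; ring
  have ha0 : ∀ n, 0 ≤ a n := by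
    intro n
    have : Real.exp (-(n / A)) ≤ Real.exp (-(n / B)) := by
      rw [Real.exp_le_exp, neg_le_neg_iff]
      exact div_le_div_of_nonneg_left (Nat.cast_nonneg n) hA (by linarith)
    simp only [ha]
    exact div_nonneg (mul_nonneg (by positivity) (by linarith)) (Nat.cast_nonneg n)
  have hsa : Summable a := by
    have : a = fun n => ‖divisorSumChar χ n‖ ^ 2 * (n.divisors.card : ℝ) ^ 2 * Real.exp (-(n / B)) / n -
        ‖divisorSumChar χ n‖ ^ 2 * (n.divisors.card : ℝ) ^ 2 * Real.exp (-(n / A)) / n := by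
      funext n; simp only [ha]; ring
    rw [this]; exact hsB.sub hsA
  rw [hre]
  calc ∑ n ∈ Finset.Ioc M N, ‖divisorSumChar χ n‖ ^ 2 * (n.divisors.card : ℝ) ^ 2 / n
      ≤ ∑ n ∈ Finset.Ioc M N, 6 * a n := by
        refine Finset.sum_le_sum fun n hn => ?_
        rw [Finset.mem_Ioc] at hn
        have hAn : A < n := lt_of_le_of_lt hM (by exact_mod_cast hn.1)
        have hnB : (n : ℝ) ≤ B := le_trans (by exact_mod_cast hn.2) hN
        have hw := one_sixth_le_exp_sub_exp hA hAB hAn hnB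
        have hn0 : (0 : ℝ) < n := hA.trans hAn
        simp only [ha]
        rw [mul_div_assoc', div_le_div_iff_of_pos_right hn0]
        have h0 : 0 ≤ ‖divisorSumChar χ n‖ ^ 2 * (n.divisors.card : ℝ) ^ 2 := by positivity
        nlinarith
    _ = 6 * ∑ n ∈ Finset.Ioc M N, a n := by rw [Finset.mul_sum]
    _ ≤ 6 * ∑' n, a n := by
        gcongr
        exact hsa.sum_le_tsum _ fun n _ => ha0 n

/-! ### §4. Bounds in the strip `−1/4 ≤ re z ≤ 2` -/

/-- `‖φ*(1+z)‖ ≤ 64^{ω(D)} e^{7659 P}` for `re z ≥ −1/4` (`χ² = 1`; `P = ∑_p p^{-3/2}`). [folklore] -/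
theorem norm_phiStar_one_add_le (hχ : χ ^ 2 = 1) {z : ℂ} (h1 : -(1 / 4) ≤ z.re) :
    ‖phiStar χ (1 + z)‖ ≤ (64 : ℝ) ^ D.primeFactors.card * Real.exp (7659 * Psum) :=
  norm_phiStar_le χ hχ (σ₀ := 3 / 4) (by norm_num) (by simp; linarith)

/-- `‖g(z)‖ ≤ (D ‖1+z‖ Z)⁸ · 64^{ω(D)} e^{7659 P}` for `re z ≥ −1/4` (`χ ≠ 1`, `χ² = 1`). [folklore] -/
theorem norm_gF8_le (hχ : χ ^ 2 = 1) (hχ1 : χ ≠ 1) {z : ℂ} (h1 : -(1 / 4) ≤ z.re) :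
    ‖gF8 χ z‖ ≤ ((D : ℝ) * ‖1 + z‖ * Zconst) ^ 8 *
      ((64 : ℝ) ^ D.primeFactors.card * Real.exp (7659 * Psum)) := by
  rw [gF8, norm_mul, norm_pow]
  have hL := norm_LFunction_one_add_le χ hχ1 h1
  have hφ := norm_phiStar_one_add_le χ hχ h1
  have h0 : 0 ≤ ‖χ.LFunction (1 + z)‖ := norm_nonneg _
  gcongr

variable (A B) in
/-- The constant of the strip bound for `F`. [folklore] -/
def KF8 (D : ℕ) : ℝ :=
  4 ^ 8 * 5 ^ 32 * (4 * CΓ) * MX A B * (((D : ℝ) * Zconst) ^ 8 * 6561 *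
    ((64 : ℝ) ^ D.primeFactors.card * Real.exp (7659 * Psum)))

omit [NeZero D] in
/-- `K_F ≥ 0`. [folklore] -/
theorem KF8_nonneg (hA : 0 < A) (hB : 0 < B) (D : ℕ) : 0 ≤ KF8 A B D := by
  unfold KF8 MX
  have := CΓ_pos
  have := Zconst_nonneg
  positivity

/-- **`F` in the strip**: for `χ ≠ 1`, `χ² = 1`, `−1/4 ≤ re z ≤ 2`, `‖z‖ ≥ 1/4`,
`‖F(z)‖ ≤ K_F (1+|im z|)⁴³ e^{-π|im z|/2}`. [folklore] -/
theorem norm_Fint8_le (hχ : χ ^ 2 = 1) (hχ1 : χ ≠ 1) (hA : 0 < A) (hB : 0 < B) {z : ℂ}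
    (h1 : -(1 / 4) ≤ z.re) (h2 : z.re ≤ 2) (hz : 1 / 4 ≤ ‖z‖) :
    ‖Fint8 χ A B z‖ ≤ KF8 A B D * ((1 + |z.im|) ^ 43 * Real.exp (-(π * |z.im| / 2))) := by
  have hy0 := abs_nonneg z.im
  have hz0 : z ≠ 0 := by
    intro h; rw [h, norm_zero] at hz; norm_num at hz
  have hzpos : 0 < ‖z‖ := by linarith
  have hzn : ‖z‖ ≤ 2 + |z.im| := by
    have := Complex.norm_le_abs_re_add_abs_im z
    have : |z.re| ≤ 2 := abs_le.2 ⟨by linarith, h2⟩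
    linarith
  have h1z : ‖(1 : ℂ) + z‖ ≤ 3 * (1 + |z.im|) := by
    have := norm_add_le (1 : ℂ) z
    rw [norm_one] at this
    linarith
  have hz1 : (1 : ℂ) + z ≠ 1 := by intro h; exact hz0 (by linear_combination h)
  -- ζ(1+z) = ζ₁(1+z)/z
  have hζ₁ : ‖riemannZeta₁ (1 + z)‖ ≤ 5 ^ 4 * (1 + |z.im|) ^ 4 := by
    have h := BurnolVectors.norm_riemannZeta₁_le (s := 1 + z) (by simp; linarith)
    refine h.trans ?_
    have : ‖(1 : ℂ) + z‖ + 2 ≤ 5 * (1 + |z.im|) := by linarith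
    calc (‖(1 : ℂ) + z‖ + 2) ^ 4 ≤ (5 * (1 + |z.im|)) ^ 4 := by gcongr
      _ = 5 ^ 4 * (1 + |z.im|) ^ 4 := by ring
  have hζ : ‖riemannZeta (1 + z)‖ ≤ 4 * (5 ^ 4 * (1 + |z.im|) ^ 4) := by
    have e : riemannZeta (1 + z) = riemannZeta₁ (1 + z) / z := by
      rw [LFunctions.riemannZeta₁_eq_mul hz1, add_sub_cancel_left]
      field_simp
    rw [e, norm_div, div_le_iff₀ hzpos]
    calc ‖riemannZeta₁ (1 + z)‖ ≤ 5 ^ 4 * (1 + |z.im|) ^ 4 := hζ₁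
      _ = 4 * (5 ^ 4 * (1 + |z.im|) ^ 4) * (1 / 4) := by ring
      _ ≤ 4 * (5 ^ 4 * (1 + |z.im|) ^ 4) * ‖z‖ := by gcongr
  have hζ8 : ‖riemannZeta (1 + z)‖ ^ 8 ≤ 4 ^ 8 * 5 ^ 32 * (1 + |z.im|) ^ 32 := by
    calc ‖riemannZeta (1 + z)‖ ^ 8 ≤ (4 * (5 ^ 4 * (1 + |z.im|) ^ 4)) ^ 8 :=
          pow_le_pow_left₀ (norm_nonneg _) hζ 8
      _ = 4 ^ 8 * 5 ^ 32 * (1 + |z.im|) ^ 32 := by ring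
  -- Γ(z) = Γ(z+1)/z
  have hΓ1 : ‖Complex.Gamma (z + 1)‖ ≤ CΓ * (1 + |z.im|) ^ 3 * Real.exp (-(π * |z.im| / 2)) := by
    have := norm_Gamma_strip_le (x := z.re + 1) (by linarith) (by linarith) z.im
    have e : ((z.re + 1 : ℝ) : ℂ) + z.im * I = z + 1 := by
      rw [show ((z.re + 1 : ℝ) : ℂ) = (z.re : ℂ) + 1 by push_cast; ring]
      conv_rhs => rw [← Complex.re_add_im z]
      ring
    rwa [e] at this
  have hΓ : ‖Complex.Gamma z‖ ≤ 4 * CΓ * (1 + |z.im|) ^ 3 * Real.exp (-(π * |z.im| / 2)) := by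
    have e : Complex.Gamma z = Complex.Gamma (z + 1) / z := by
      rw [Complex.Gamma_add_one _ hz0]; field_simp
    rw [e, norm_div, div_le_iff₀ hzpos]
    have hC := CΓ_pos
    have hE := Real.exp_pos (-(π * |z.im| / 2))
    calc ‖Complex.Gamma (z + 1)‖ ≤ CΓ * (1 + |z.im|) ^ 3 * Real.exp (-(π * |z.im| / 2)) := hΓ1
      _ = 4 * CΓ * (1 + |z.im|) ^ 3 * Real.exp (-(π * |z.im| / 2)) * (1 / 4) := by ring
      _ ≤ 4 * CΓ * (1 + |z.im|) ^ 3 * Real.exp (-(π * |z.im| / 2)) * ‖z‖ := by gcongr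
  -- B^z − A^z
  have hAB : ‖(B : ℂ) ^ z - (A : ℂ) ^ z‖ ≤ MX A B := by
    refine (norm_sub_le _ _).trans ?_
    rw [Complex.norm_cpow_eq_rpow_re_of_pos hB, Complex.norm_cpow_eq_rpow_re_of_pos hA, MX]
    exact add_le_add (rpow_le_rpow_add hB h1 h2) (rpow_le_rpow_add hA h1 h2)
  -- g
  have hΦ : 0 ≤ (64 : ℝ) ^ D.primeFactors.card * Real.exp (7659 * Psum) := by positivity
  have hZ0 := Zconst_nonneg
  have hg : ‖gF8 χ z‖ ≤ ((D : ℝ) * Zconst) ^ 8 * 6561 *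
      ((64 : ℝ) ^ D.primeFactors.card * Real.exp (7659 * Psum)) * (1 + |z.im|) ^ 8 := by
    refine (norm_gF8_le χ hχ hχ1 h1).trans ?_
    calc ((D : ℝ) * ‖(1 : ℂ) + z‖ * Zconst) ^ 8 * ((64 : ℝ) ^ D.primeFactors.card * Real.exp (7659 * Psum))
        ≤ ((D : ℝ) * (3 * (1 + |z.im|)) * Zconst) ^ 8 *
            ((64 : ℝ) ^ D.primeFactors.card * Real.exp (7659 * Psum)) := by gcongr
      _ = _ := by ring
  -- combine
  have hE := Real.exp_pos (-(π * |z.im| / 2))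
  have hC := CΓ_pos
  have hMX : 0 ≤ MX A B := by unfold MX; positivity
  have s1 : ‖riemannZeta (1 + z)‖ ^ 8 * ‖Complex.Gamma z‖ ≤
      (4 ^ 8 * 5 ^ 32 * (1 + |z.im|) ^ 32) * (4 * CΓ * (1 + |z.im|) ^ 3 * Real.exp (-(π * |z.im| / 2))) :=
    mul_le_mul hζ8 hΓ (norm_nonneg _) (by positivity)
  have s2 : ‖riemannZeta (1 + z)‖ ^ 8 * ‖Complex.Gamma z‖ * ‖(B : ℂ) ^ z - (A : ℂ) ^ z‖ ≤
      (4 ^ 8 * 5 ^ 32 * (1 + |z.im|) ^ 32) * (4 * CΓ * (1 + |z.im|) ^ 3 * Real.exp (-(π * |z.im| / 2))) *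
        MX A B :=
    mul_le_mul s1 hAB (norm_nonneg _) (by positivity)
  have s3 : ‖riemannZeta (1 + z)‖ ^ 8 * ‖Complex.Gamma z‖ * ‖(B : ℂ) ^ z - (A : ℂ) ^ z‖ * ‖gF8 χ z‖ ≤
      (4 ^ 8 * 5 ^ 32 * (1 + |z.im|) ^ 32) * (4 * CΓ * (1 + |z.im|) ^ 3 * Real.exp (-(π * |z.im| / 2))) *
        MX A B * (((D : ℝ) * Zconst) ^ 8 * 6561 *
          ((64 : ℝ) ^ D.primeFactors.card * Real.exp (7659 * Psum)) * (1 + |z.im|) ^ 8) :=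
    mul_le_mul s2 hg (norm_nonneg _) (by positivity)
  rw [Fint8, norm_mul, norm_mul, norm_mul, norm_pow]
  refine s3.trans (le_of_eq ?_)
  rw [KF8]; ring

/-- `y ↦ F(c+iy)` is continuous for `c > −1/2`, `c ≠ 0`. [folklore] -/
theorem continuous_Fint8_line (hχ : χ ^ 2 = 1) (hχ1 : χ ≠ 1) (hA : 0 < A) (hB : 0 < B) {c : ℝ}
    (hc : -(1 / 2) < c) (hc0 : c ≠ 0) :
    Continuous fun y : ℝ => Fint8 χ A B (c + y * I) := by
  have hd := differentiableOn_Fint8 χ hχ hχ1 hA hB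
  have hline : Continuous fun y : ℝ => (c : ℂ) + y * I := by fun_prop
  refine hd.continuousOn.comp_continuous hline fun y => ⟨?_, ?_⟩
  · simp only [mem_setOf_eq, add_re, ofReal_re, mul_re, I_re, mul_zero, ofReal_im, I_im, mul_one,
      sub_self, add_zero]; exact hc
  · intro h
    have := congrArg Complex.re h
    simp at this
    exact hc0 this

/-- Integrability of `F` on the lines `re z = −1/4` and `re z = 2`. [folklore] -/
theorem integrable_Fint8_line (hχ : χ ^ 2 = 1) (hχ1 : χ ≠ 1) (hA : 0 < A) (hB : 0 < B) {c : ℝ}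
    (hc : c = -(1 / 4) ∨ c = 2) :
    Integrable fun y : ℝ => Fint8 χ A B (c + y * I) := by
  have hc1 : -(1 / 4) ≤ c := by rcases hc with h | h <;> norm_num [h]
  have hc2 : c ≤ 2 := by rcases hc with h | h <;> norm_num [h]
  have hca : 1 / 4 ≤ |c| := by
    rcases hc with h | h <;> (rw [h]; norm_num [abs_of_neg, abs_of_pos])
  have hc0 : c ≠ 0 := by intro h; rw [h] at hca; norm_num at hca
  have hcont := continuous_Fint8_line χ hχ hχ1 hA hB (c := c) (by linarith) hc0
  refine (((integrable_pow_mul_exp 43).const_mul (KF8 A B D)).mono' hcont.aestronglyMeasurable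
    (Eventually.of_forall fun y => ?_))
  have hw : 1 / 4 ≤ ‖((c : ℂ) + y * I)‖ := by
    have hre : (((c : ℂ) + y * I)).re = c := by simp
    have := abs_re_le_norm (((c : ℂ) + y * I))
    rw [hre] at this
    exact hca.trans this
  have him : (((c : ℂ) + y * I)).im = y := by simp
  have hb := norm_Fint8_le χ hχ hχ1 hA hB (z := ((c : ℂ) + y * I)) (by simpa using hc1)
    (by simpa using hc2) hw
  rw [him] at hb
  exact hb

/-- Horizontal decay of `F` in the strip. [folklore] -/
theorem Fint8_horizontal_decay (hχ : χ ^ 2 = 1) (hχ1 : χ ≠ 1) (hA : 0 < A) (hB : 0 < B)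
    (ε : ℝ) (hε : 0 < ε) :
    ∃ T₀ : ℝ, ∀ T : ℝ, T₀ ≤ |T| → ∀ u ∈ Icc (-(1 / 4) : ℝ) 2, ‖Fint8 χ A B (u + T * I)‖ ≤ ε := by
  have hK0 := KF8_nonneg hA hB D
  obtain ⟨T₁, hT₁⟩ := exists_pow_mul_exp_le 43 hK0 hε
  refine ⟨max T₁ 1, fun T hT u hu => ?_⟩
  have hTT : T₁ ≤ |T| := le_trans (le_max_left _ _) hT
  have hT1 : 1 ≤ |T| := le_trans (le_max_right _ _) hT
  set w : ℂ := (u : ℂ) + T * I with hw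
  have hwim : w.im = T := by simp [hw]
  have hwre : w.re = u := by simp [hw]
  have hwn : 1 / 4 ≤ ‖w‖ := by
    have := abs_im_le_norm w; rw [hwim] at this; linarith
  have hb := norm_Fint8_le χ hχ hχ1 hA hB (z := w) (by rw [hwre]; exact hu.1) (by rw [hwre]; exact hu.2) hwn
  rw [hwim] at hb
  exact hb.trans (hT₁ T hTT)

/-! ### §5. The `L`-size input and the line `re z = −1/4` with the `D`-dependence explicit -/

/-- **The `L`-size input of the printed Lemma 3.2**, as a hypothesis on ONE character: on the line
`re s = 3/4`, `‖L(s, χ)‖ ≤ C_L · D^κ · (1 + |im s|)^b`. Discharged (for every primitive `χ` mod `D`,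
with `C_L = C_L(ε)`, any `ε > 0`) by: Burgess's bound `L(½+it,χ) ≪ q^{3/16+ε}(|t|+1)` and the
Phragmén–Lindelöf principle, `κ = 3/32 + ε`, `b = 1` [cite: IwaniecKowalski2004, Thm 12.9]; the
Weyl-strength bound, `κ = 1/12 + ε` [cite: PetrowYoung2023, Thm 1.1]; NOT by the convexity /
Pólya–Vinogradov bound (`κ = 1/8` times `log`, the boundary case; the tree's
`DirichletAbel.norm_LFunction_le_polyaVinogradov_of_half_le`). It is used below only with `κ < 1/8`.
-/
def LBound (κ : ℝ) (b : ℕ) (CL : ℝ) : Prop :=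
  ∀ s : ℂ, s.re = 3 / 4 → ‖χ.LFunction s‖ ≤ CL * (D : ℝ) ^ κ * (1 + |s.im|) ^ b

/-- The absolute constant of the line bound. [folklore] -/
def Kline8 : ℝ := 4 ^ 9 * 5 ^ 32 * CΓ * Real.exp (7659 * Psum)

omit [NeZero D] in
/-- `Kline8 > 0`. [folklore] -/
theorem Kline8_pos : 0 < Kline8 := by unfold Kline8; have := CΓ_pos; positivity

omit [NeZero D] in
/-- `64^{ω(D)} ≤ d(D)⁶` (`2^{ω(D)} ≤ d(D)`), `D ≠ 0`. [folklore] -/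
theorem pow64_card_primeFactors_le (hD0 : D ≠ 0) :
    (64 : ℝ) ^ D.primeFactors.card ≤ (D.divisors.card : ℝ) ^ 6 := by
  have h2 : 2 ^ D.primeFactors.card ≤ D.divisors.card := by
    rw [Nat.card_divisors hD0]
    refine Finset.pow_card_le_prod _ _ _ fun p hp => ?_
    have hp := Nat.mem_primeFactors.mp hp
    have hpos : 0 < D.factorization p := hp.1.factorization_pos_of_dvd hD0 hp.2.1
    omega
  have h2' : (2 : ℝ) ^ D.primeFactors.card ≤ (D.divisors.card : ℝ) := by exact_mod_cast h2
  calc (64 : ℝ) ^ D.primeFactors.card = ((2 : ℝ) ^ D.primeFactors.card) ^ 6 := by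
        rw [← pow_mul, mul_comm, pow_mul]; norm_num
    _ ≤ (D.divisors.card : ℝ) ^ 6 := pow_le_pow_left₀ (by positivity) h2' 6

/-- **`F` on the line `re z = −1/4`, given `LBound χ κ b C_L`** (`χ` mod `D ≠ 0`, `χ² = 1`,
`C_L ≥ 0`):
`‖F(−1/4+iy)‖ ≤ K (C_L D^κ)⁸ d(D)⁶ (A^{-1/4}+B^{-1/4}) (1+|y|)^{35+8b} e^{-π|y|/2}`. [folklore] -/
theorem norm_Fint8_line_le (hχ : χ ^ 2 = 1) (hD0 : D ≠ 0) {κ : ℝ} {b : ℕ} {CL : ℝ}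
    (hCL : 0 ≤ CL) (hLB : LBound χ κ b CL) (hA : 0 < A) (hB : 0 < B) (y : ℝ) :
    ‖Fint8 χ A B (((-(1 / 4) : ℝ) : ℂ) + y * I)‖ ≤
      Kline8 * (CL * (D : ℝ) ^ κ) ^ 8 * (D.divisors.card : ℝ) ^ 6 *
        (A ^ (-(1 / 4) : ℝ) + B ^ (-(1 / 4) : ℝ)) *
        ((1 + |y|) ^ (35 + 8 * b) * Real.exp (-(π * |y| / 2))) := by
  have hDpos : (0 : ℝ) < D := by exact_mod_cast Nat.pos_of_ne_zero hD0
  generalize hzdef : (((-(1 / 4) : ℝ) : ℂ) + y * I) = z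
  have hzre : z.re = -(1 / 4) := by rw [← hzdef]; simp
  have hzim : z.im = y := by rw [← hzdef]; simp
  have hy0 := abs_nonneg y
  have hz : 1 / 4 ≤ ‖z‖ := by
    have := Complex.abs_re_le_norm z
    rw [hzre, abs_neg, abs_of_pos (by norm_num : (0:ℝ) < 1 / 4)] at this
    exact this
  have hzpos : 0 < ‖z‖ := by linarith
  have hz0 : z ≠ 0 := by
    intro h; rw [h, norm_zero] at hz; norm_num at hz
  have hzn : ‖z‖ ≤ 1 / 4 + |y| := by
    have := Complex.norm_le_abs_re_add_abs_im z
    rw [hzre, hzim, abs_neg, abs_of_pos (by norm_num : (0:ℝ) < 1 / 4)] at this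
    exact this
  have h1z : ‖(1 : ℂ) + z‖ ≤ 3 * (1 + |y|) := by
    have := norm_add_le (1 : ℂ) z
    rw [norm_one] at this
    linarith
  have hz1 : (1 : ℂ) + z ≠ 1 := by intro h; exact hz0 (by linear_combination h)
  -- ζ(1+z)⁸ Γ(z) as in the strip bound
  have hζ₁ : ‖riemannZeta₁ (1 + z)‖ ≤ 5 ^ 4 * (1 + |y|) ^ 4 := by
    have h := BurnolVectors.norm_riemannZeta₁_le (s := 1 + z) (by rw [add_re, one_re, hzre]; norm_num)
    refine h.trans ?_
    have : ‖(1 : ℂ) + z‖ + 2 ≤ 5 * (1 + |y|) := by linarith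
    calc (‖(1 : ℂ) + z‖ + 2) ^ 4 ≤ (5 * (1 + |y|)) ^ 4 := by gcongr
      _ = 5 ^ 4 * (1 + |y|) ^ 4 := by ring
  have hζ : ‖riemannZeta (1 + z)‖ ≤ 4 * (5 ^ 4 * (1 + |y|) ^ 4) := by
    have e : riemannZeta (1 + z) = riemannZeta₁ (1 + z) / z := by
      rw [LFunctions.riemannZeta₁_eq_mul hz1, add_sub_cancel_left]
      field_simp
    rw [e, norm_div, div_le_iff₀ hzpos]
    calc ‖riemannZeta₁ (1 + z)‖ ≤ 5 ^ 4 * (1 + |y|) ^ 4 := hζ₁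
      _ = 4 * (5 ^ 4 * (1 + |y|) ^ 4) * (1 / 4) := by ring
      _ ≤ 4 * (5 ^ 4 * (1 + |y|) ^ 4) * ‖z‖ := by gcongr
  have hζ8 : ‖riemannZeta (1 + z)‖ ^ 8 ≤ 4 ^ 8 * 5 ^ 32 * (1 + |y|) ^ 32 := by
    calc ‖riemannZeta (1 + z)‖ ^ 8 ≤ (4 * (5 ^ 4 * (1 + |y|) ^ 4)) ^ 8 :=
          pow_le_pow_left₀ (norm_nonneg _) hζ 8
      _ = 4 ^ 8 * 5 ^ 32 * (1 + |y|) ^ 32 := by ring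
  have hΓ1 : ‖Complex.Gamma (z + 1)‖ ≤ CΓ * (1 + |y|) ^ 3 * Real.exp (-(π * |y| / 2)) := by
    have := norm_Gamma_strip_le (x := z.re + 1) (by rw [hzre]; norm_num) (by rw [hzre]; norm_num) z.im
    have e : ((z.re + 1 : ℝ) : ℂ) + z.im * I = z + 1 := by
      rw [show ((z.re + 1 : ℝ) : ℂ) = (z.re : ℂ) + 1 by push_cast; ring]
      conv_rhs => rw [← Complex.re_add_im z]
      ring
    rwa [e, hzim] at this
  have hC := CΓ_pos
  have hE := Real.exp_pos (-(π * |y| / 2))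
  have hΓ : ‖Complex.Gamma z‖ ≤ 4 * CΓ * (1 + |y|) ^ 3 * Real.exp (-(π * |y| / 2)) := by
    have e : Complex.Gamma z = Complex.Gamma (z + 1) / z := by
      rw [Complex.Gamma_add_one _ hz0]; field_simp
    rw [e, norm_div, div_le_iff₀ hzpos]
    calc ‖Complex.Gamma (z + 1)‖ ≤ CΓ * (1 + |y|) ^ 3 * Real.exp (-(π * |y| / 2)) := hΓ1
      _ = 4 * CΓ * (1 + |y|) ^ 3 * Real.exp (-(π * |y| / 2)) * (1 / 4) := by ring
      _ ≤ 4 * CΓ * (1 + |y|) ^ 3 * Real.exp (-(π * |y| / 2)) * ‖z‖ := by gcongr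
  -- B^z − A^z on the line
  have hAB : ‖(B : ℂ) ^ z - (A : ℂ) ^ z‖ ≤ A ^ (-(1 / 4) : ℝ) + B ^ (-(1 / 4) : ℝ) := by
    refine (norm_sub_le _ _).trans ?_
    rw [Complex.norm_cpow_eq_rpow_re_of_pos hB, Complex.norm_cpow_eq_rpow_re_of_pos hA, hzre]
    linarith
  -- L(1+z)⁸ by the HYPOTHESIS `LBound`, φ* by `norm_phiStar_le`
  have hsre : ((1 : ℂ) + z).re = 3 / 4 := by rw [add_re, one_re, hzre]; norm_num
  have hsim : ((1 : ℂ) + z).im = y := by rw [add_im, one_im, hzim, zero_add]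
  have hLz : ‖χ.LFunction (1 + z)‖ ≤ CL * (D : ℝ) ^ κ * (1 + |y|) ^ b := by
    have := hLB (1 + z) hsre
    rwa [hsim] at this
  have hDκ : 0 ≤ CL * (D : ℝ) ^ κ := mul_nonneg hCL (Real.rpow_nonneg hDpos.le κ)
  have hL8 : ‖χ.LFunction (1 + z)‖ ^ 8 ≤ (CL * (D : ℝ) ^ κ) ^ 8 * ((1 + |y|) ^ b) ^ 8 := by
    calc ‖χ.LFunction (1 + z)‖ ^ 8 ≤ (CL * (D : ℝ) ^ κ * (1 + |y|) ^ b) ^ 8 :=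
          pow_le_pow_left₀ (norm_nonneg _) hLz 8
      _ = (CL * (D : ℝ) ^ κ) ^ 8 * ((1 + |y|) ^ b) ^ 8 := by ring
  have hφ : ‖phiStar χ (1 + z)‖ ≤ (D.divisors.card : ℝ) ^ 6 * Real.exp (7659 * Psum) := by
    refine (norm_phiStar_one_add_le χ hχ (z := z) (by rw [hzre])).trans ?_
    have := pow64_card_primeFactors_le (D := D) hD0
    gcongr
  have hg : ‖gF8 χ z‖ ≤ ((CL * (D : ℝ) ^ κ) ^ 8 * ((1 + |y|) ^ b) ^ 8) *
      ((D.divisors.card : ℝ) ^ 6 * Real.exp (7659 * Psum)) := by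
    rw [gF8, norm_mul, norm_pow]
    exact mul_le_mul hL8 hφ (norm_nonneg _) (by positivity)
  -- combine
  have hAB0 : 0 ≤ A ^ (-(1 / 4) : ℝ) + B ^ (-(1 / 4) : ℝ) := by positivity
  have s1 : ‖riemannZeta (1 + z)‖ ^ 8 * ‖Complex.Gamma z‖ ≤
      (4 ^ 8 * 5 ^ 32 * (1 + |y|) ^ 32) * (4 * CΓ * (1 + |y|) ^ 3 * Real.exp (-(π * |y| / 2))) :=
    mul_le_mul hζ8 hΓ (norm_nonneg _) (by positivity)
  have s2 : ‖riemannZeta (1 + z)‖ ^ 8 * ‖Complex.Gamma z‖ * ‖(B : ℂ) ^ z - (A : ℂ) ^ z‖ ≤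
      (4 ^ 8 * 5 ^ 32 * (1 + |y|) ^ 32) * (4 * CΓ * (1 + |y|) ^ 3 * Real.exp (-(π * |y| / 2))) *
        (A ^ (-(1 / 4) : ℝ) + B ^ (-(1 / 4) : ℝ)) :=
    mul_le_mul s1 hAB (norm_nonneg _) (by positivity)
  have s3 : ‖riemannZeta (1 + z)‖ ^ 8 * ‖Complex.Gamma z‖ * ‖(B : ℂ) ^ z - (A : ℂ) ^ z‖ * ‖gF8 χ z‖ ≤
      (4 ^ 8 * 5 ^ 32 * (1 + |y|) ^ 32) * (4 * CΓ * (1 + |y|) ^ 3 * Real.exp (-(π * |y| / 2))) *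
        (A ^ (-(1 / 4) : ℝ) + B ^ (-(1 / 4) : ℝ)) *
        (((CL * (D : ℝ) ^ κ) ^ 8 * ((1 + |y|) ^ b) ^ 8) *
          ((D.divisors.card : ℝ) ^ 6 * Real.exp (7659 * Psum))) :=
    mul_le_mul s2 hg (norm_nonneg _) (by positivity)
  rw [Fint8, norm_mul, norm_mul, norm_mul, norm_pow]
  refine s3.trans (le_of_eq ?_)
  rw [Kline8]; ring

/-- The numerical factor `∫ (1+|y|)^{35+8b} e^{-π|y|/2} dy ≤ M_b := 2(72+16b)^{35+8b}`. [folklore] -/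
def Mline8 (b : ℕ) : ℝ := 2 * (2 * ((35 + 8 * b : ℕ) : ℝ) + 2) ^ (35 + 8 * b)

omit [NeZero D] in
/-- `M_b ≥ 0`. [folklore] -/
theorem Mline8_nonneg (b : ℕ) : 0 ≤ Mline8 b := by unfold Mline8; positivity

/-- **The shifted integral, given `LBound χ κ b C_L`**:
`‖∫ F(−1/4+iy) dy‖ ≤ M_b · K (C_L D^κ)⁸ d(D)⁶ (A^{-1/4}+B^{-1/4})`. [folklore] -/
theorem norm_integral_Fint8_line_le (hχ : χ ^ 2 = 1) (hD0 : D ≠ 0) {κ : ℝ} {b : ℕ}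
    {CL : ℝ} (hCL : 0 ≤ CL) (hLB : LBound χ κ b CL) (hA : 0 < A) (hB : 0 < B) :
    ‖∫ y : ℝ, Fint8 χ A B (((-(1 / 4) : ℝ) : ℂ) + y * I)‖ ≤
      Mline8 b * (Kline8 * (CL * (D : ℝ) ^ κ) ^ 8 * (D.divisors.card : ℝ) ^ 6 *
        (A ^ (-(1 / 4) : ℝ) + B ^ (-(1 / 4) : ℝ))) := by
  set K : ℝ := Kline8 * (CL * (D : ℝ) ^ κ) ^ 8 * (D.divisors.card : ℝ) ^ 6 *
    (A ^ (-(1 / 4) : ℝ) + B ^ (-(1 / 4) : ℝ)) with hK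
  have hDpos : (0 : ℝ) < D := by exact_mod_cast Nat.pos_of_ne_zero hD0
  have hK0 : 0 ≤ K := by
    rw [hK]; have := Kline8_pos
    have : 0 ≤ CL * (D : ℝ) ^ κ := mul_nonneg hCL (Real.rpow_nonneg hDpos.le κ)
    positivity
  have hbound : ∀ y : ℝ, ‖Fint8 χ A B (((-(1 / 4) : ℝ) : ℂ) + y * I)‖ ≤
      K * ((1 + |y|) ^ (35 + 8 * b) * Real.exp (-(π * |y| / 2))) := by
    intro y
    have hb := norm_Fint8_line_le χ hχ hD0 hCL hLB hA hB y
    rw [← hK] at hb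
    exact hb
  have hint := (integrable_pow_mul_exp (35 + 8 * b)).const_mul K
  calc ‖∫ y : ℝ, Fint8 χ A B (((-(1 / 4) : ℝ) : ℂ) + y * I)‖
      ≤ ∫ y : ℝ, K * ((1 + |y|) ^ (35 + 8 * b) * Real.exp (-(π * |y| / 2))) :=
        norm_integral_le_of_norm_le hint (Eventually.of_forall hbound)
    _ = K * ∫ y : ℝ, (1 + |y|) ^ (35 + 8 * b) * Real.exp (-(π * |y| / 2)) := integral_const_mul _ _
    _ ≤ K * (2 * (2 * ((35 + 8 * b : ℕ) : ℝ) + 2) ^ (35 + 8 * b)) := by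
        gcongr; exact integral_pow_mul_exp_le (35 + 8 * b)
    _ = Mline8 b * K := by rw [Mline8]; ring

/-! ### §6. Near `z = 0`: the residue of the pole of order eight -/

/-- The absolute constant of the residue bound. [folklore] -/
def Kres8 : ℝ := (13 / 4 : ℝ) ^ 32 * (2 * CΓ) * Real.exp (7659 * Psum) * (1 + 4 * Real.exp (9 / 2)) ^ 8

omit [NeZero D] in
/-- `Kres8 ≥ 0`. [folklore] -/
theorem Kres8_nonneg : 0 ≤ Kres8 := by unfold Kres8; have := CΓ_pos; positivity

/-- **`h` on the circle `|z| = 𝓛^{-2024}`** (`χ` primitive mod `D`, `χ² = 1`, `𝓛 = log D ≥ 3`,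
(A) `‖L(1,χ)‖ ≤ 𝓛^{-2022}`, `1 ≤ A, B`, `log A, log B ≤ 8𝓛`):
`‖h(z)‖ ≤ K_res · 2(log A + log B) · 𝓛^{-16176}`. [cite: Zhang2022LandauSiegel, §3, Lemma 3.2
("the residue … is ≪ 𝓛^{-2007}": `(1 ∗ χ)(n)²τ₂(n)² n^{-s}` has a pole of order eight at `s = 1`)] -/
theorem norm_hnum8_le_sphere (hχ : χ ^ 2 = 1) (hprim : χ.IsPrimitive) (hL : 3 ≤ Real.log D)
    (hLA : ‖χ.LFunction 1‖ ≤ 1 / Real.log D ^ 2022) (hA1 : 1 ≤ A) (hB1 : 1 ≤ B)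
    (hAL : Real.log A ≤ 8 * Real.log D) (hBL : Real.log B ≤ 8 * Real.log D) {z : ℂ}
    (hz : ‖z‖ = 1 / Real.log D ^ 2024) :
    ‖hnum8 χ A B z‖ ≤ Kres8 * (2 * (Real.log A + Real.log B)) / (Real.log D ^ 2022) ^ 8 := by
  set Lg : ℝ := Real.log D with hLdef
  have hL1 : 1 ≤ Lg := by linarith
  have hL0 : 0 < Lg := by linarith
  have hD0 : D ≠ 0 := by
    rintro rfl; simp [hLdef] at hL; linarith
  have hDpos : (0 : ℝ) < D := by exact_mod_cast Nat.pos_of_ne_zero hD0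
  have hlA : 0 ≤ Real.log A := Real.log_nonneg hA1
  have hlB : 0 ≤ Real.log B := Real.log_nonneg hB1
  -- sizes of `r = 𝓛^{-2024}`
  have hL2 : (9 : ℝ) ≤ Lg ^ 2024 := by
    calc (9 : ℝ) = 3 ^ 2 := by norm_num
      _ ≤ Lg ^ 2 := pow_le_pow_left₀ (by norm_num) hL 2
      _ ≤ Lg ^ 2024 := pow_le_pow_right₀ hL1 (by norm_num)
  have hr9 : ‖z‖ ≤ 1 / 9 := by
    rw [hz]; exact div_le_div_of_nonneg_left (by norm_num) (by norm_num) hL2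
  have hrL : ‖z‖ * Lg ≤ 1 / Lg ^ 2023 := by
    rw [hz]
    have : Lg ^ 2024 = Lg ^ 2023 * Lg := by rw [pow_succ]
    rw [this]; field_simp; exact le_rfl
  have hL2023 : (9 : ℝ) ≤ Lg ^ 2023 := by
    calc (9 : ℝ) = 3 ^ 2 := by norm_num
      _ ≤ Lg ^ 2 := pow_le_pow_left₀ (by norm_num) hL 2
      _ ≤ Lg ^ 2023 := pow_le_pow_right₀ hL1 (by norm_num)
  have hrL1 : ‖z‖ * Lg ≤ 1 := hrL.trans (by rw [div_le_one (by positivity)]; linarith)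
  have hrL8 : ‖z‖ * (8 * Lg) ≤ 1 := by
    have : ‖z‖ * (8 * Lg) = 8 * (‖z‖ * Lg) := by ring
    rw [this]
    calc 8 * (‖z‖ * Lg) ≤ 8 * (1 / Lg ^ 2023) := by gcongr
      _ ≤ 1 := by rw [mul_one_div, div_le_one (by positivity)]; linarith
  have hz0 : z ≠ 0 := by
    intro h; rw [h, norm_zero] at hz
    have : (0 : ℝ) < 1 / Lg ^ 2024 := by positivity
    linarith
  have hz1L : ‖z‖ ≤ 1 / Real.log D := by
    rw [← hLdef]
    calc ‖z‖ = ‖z‖ * Lg / Lg := by field_simp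
      _ ≤ 1 / Lg := by gcongr
  have hzre : |z.re| ≤ 1 / 9 := (Complex.abs_re_le_norm z).trans hr9
  have hzim : |z.im| ≤ ‖z‖ := Complex.abs_im_le_norm z
  -- ζ₁(1+z)⁸
  have h1z : ‖(1 : ℂ) + z‖ ≤ 5 / 4 := by
    have := norm_add_le (1 : ℂ) z; rw [norm_one] at this; linarith
  have hζ₁ : ‖riemannZeta₁ (1 + z)‖ ≤ (13 / 4 : ℝ) ^ 4 := by
    have h := BurnolVectors.norm_riemannZeta₁_le (s := 1 + z)
      (by rw [add_re, one_re]; have := neg_abs_le z.re; linarith)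
    refine h.trans ?_
    have : ‖(1 : ℂ) + z‖ + 2 ≤ 13 / 4 := by linarith
    exact pow_le_pow_left₀ (by positivity) this 4
  have hζ8 : ‖riemannZeta₁ (1 + z)‖ ^ 8 ≤ (13 / 4 : ℝ) ^ 32 := by
    calc ‖riemannZeta₁ (1 + z)‖ ^ 8 ≤ ((13 / 4 : ℝ) ^ 4) ^ 8 := pow_le_pow_left₀ (norm_nonneg _) hζ₁ 8
      _ = (13 / 4 : ℝ) ^ 32 := by rw [← pow_mul]
  -- Γ(z+1)
  have hC := CΓ_pos
  have hΓ : ‖Complex.Gamma (z + 1)‖ ≤ 2 * CΓ := by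
    have := norm_Gamma_strip_le (x := z.re + 1) (by have := neg_abs_le z.re; linarith)
      (by have := le_abs_self z.re; linarith) z.im
    have e : ((z.re + 1 : ℝ) : ℂ) + z.im * I = z + 1 := by
      rw [show ((z.re + 1 : ℝ) : ℂ) = (z.re : ℂ) + 1 by push_cast; ring]
      conv_rhs => rw [← Complex.re_add_im z]
      ring
    rw [e] at this
    refine this.trans ?_
    have hy : |z.im| ≤ 1 / 9 := hzim.trans hr9
    have hE : Real.exp (-(π * |z.im| / 2)) ≤ 1 := by
      rw [Real.exp_le_one_iff]
      have := Real.pi_pos; have := abs_nonneg z.im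
      nlinarith
    calc CΓ * (1 + |z.im|) ^ 3 * Real.exp (-(π * |z.im| / 2))
        ≤ CΓ * (1 + 1 / 9) ^ 3 * 1 := by gcongr
      _ ≤ 2 * CΓ := by nlinarith
  -- ε(z)
  have hε : ‖eps A B z‖ ≤ 2 * (Real.log A + Real.log B) :=
    norm_eps_le_small hA1 hB1 hz0
      ((mul_le_mul_of_nonneg_left hAL (norm_nonneg _)).trans hrL8)
      ((mul_le_mul_of_nonneg_left hBL (norm_nonneg _)).trans hrL8)
  -- L(1+z, χ)⁸ under (A)
  have hLz : ‖χ.LFunction (1 + z)‖ ≤ (1 + 4 * Real.exp (9 / 2)) / Lg ^ 2022 := by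
    have hsub := norm_LFunction_one_add_sub_le χ hL hprim hz1L
    rw [← hLdef] at hsub
    have htri := norm_add_le (χ.LFunction (1 + z) - χ.LFunction 1) (χ.LFunction 1)
    rw [sub_add_cancel] at htri
    have hE := Real.exp_pos (9 / 2)
    have h2 : 2 * Real.exp (9 / 2) * (1 + Lg) * Lg * ‖z‖ ≤ 4 * Real.exp (9 / 2) / Lg ^ 2022 := by
      have h1L : 1 + Lg ≤ 2 * Lg := by linarith
      calc 2 * Real.exp (9 / 2) * (1 + Lg) * Lg * ‖z‖
          ≤ 2 * Real.exp (9 / 2) * (2 * Lg) * Lg * ‖z‖ := by gcongr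
        _ = 4 * Real.exp (9 / 2) * Lg * (‖z‖ * Lg) := by ring
        _ ≤ 4 * Real.exp (9 / 2) * Lg * (1 / Lg ^ 2023) := by gcongr
        _ = 4 * Real.exp (9 / 2) / Lg ^ 2022 := by
            have : Lg ^ 2023 = Lg * Lg ^ 2022 := by rw [pow_succ']
            rw [this]; field_simp
    calc ‖χ.LFunction (1 + z)‖ ≤ ‖χ.LFunction (1 + z) - χ.LFunction 1‖ + ‖χ.LFunction 1‖ := htri
      _ ≤ 2 * Real.exp (9 / 2) * (1 + Lg) * Lg * ‖z‖ + 1 / Lg ^ 2022 := add_le_add hsub hLA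
      _ ≤ 4 * Real.exp (9 / 2) / Lg ^ 2022 + 1 / Lg ^ 2022 := by linarith
      _ = (1 + 4 * Real.exp (9 / 2)) / Lg ^ 2022 := by ring
  have hL8 : ‖χ.LFunction (1 + z)‖ ^ 8 ≤ (1 + 4 * Real.exp (9 / 2)) ^ 8 / (Lg ^ 2022) ^ 8 := by
    rw [← div_pow]; exact pow_le_pow_left₀ (norm_nonneg _) hLz 8
  -- φ*(1+z): absolute bound near the real axis
  have hφ : ‖phiStar χ (1 + z)‖ ≤ Real.exp (7659 * Psum) := by
    refine norm_phiStar_le_of_re_cpow_nonneg χ hχ (σ₀ := 3 / 4) (by norm_num) (s := 1 + z)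
      (by rw [add_re, one_re]; have := neg_abs_le z.re; linarith) fun p hp hpD => ?_
    refine re_natCast_cpow_neg_nonneg hp.pos ?_
    have hpD' : (p : ℝ) ≤ D := by exact_mod_cast Nat.le_of_dvd (Nat.pos_of_ne_zero hD0) hpD
    have hlogp : Real.log p ≤ Lg := Real.log_le_log (by exact_mod_cast hp.pos) hpD'
    have hlogp0 : 0 ≤ Real.log p := Real.log_nonneg (by exact_mod_cast hp.one_lt.le)
    have him : |(1 + z : ℂ).im| = |z.im| := by simp
    rw [him]
    calc |z.im| * Real.log p ≤ ‖z‖ * Lg := mul_le_mul hzim hlogp hlogp0 (norm_nonneg _)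
      _ ≤ 1 := hrL1
      _ ≤ π / 2 := by linarith [Real.pi_gt_three]
  have hg : ‖gF8 χ z‖ ≤ (1 + 4 * Real.exp (9 / 2)) ^ 8 / (Lg ^ 2022) ^ 8 * Real.exp (7659 * Psum) := by
    rw [gF8, norm_mul, norm_pow]
    exact mul_le_mul hL8 hφ (norm_nonneg _) (by positivity)
  -- combine
  have s1 : ‖riemannZeta₁ (1 + z)‖ ^ 8 * ‖Complex.Gamma (z + 1)‖ ≤ (13 / 4 : ℝ) ^ 32 * (2 * CΓ) :=
    mul_le_mul hζ8 hΓ (norm_nonneg _) (by positivity)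
  have s2 : ‖riemannZeta₁ (1 + z)‖ ^ 8 * ‖Complex.Gamma (z + 1)‖ * ‖eps A B z‖ ≤
      (13 / 4 : ℝ) ^ 32 * (2 * CΓ) * (2 * (Real.log A + Real.log B)) :=
    mul_le_mul s1 hε (norm_nonneg _) (by positivity)
  have s3 : ‖riemannZeta₁ (1 + z)‖ ^ 8 * ‖Complex.Gamma (z + 1)‖ * ‖eps A B z‖ * ‖gF8 χ z‖ ≤
      (13 / 4 : ℝ) ^ 32 * (2 * CΓ) * (2 * (Real.log A + Real.log B)) *
        ((1 + 4 * Real.exp (9 / 2)) ^ 8 / (Lg ^ 2022) ^ 8 * Real.exp (7659 * Psum)) :=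
    mul_le_mul s2 hg (norm_nonneg _) (by positivity)
  rw [hnum8, norm_mul, norm_mul, norm_mul, norm_pow]
  refine s3.trans (le_of_eq ?_)
  rw [Kres8]; ring

/-- **Cauchy's estimate for the residue**: under the hypotheses of `norm_hnum8_le_sphere`,
`‖h⁽⁷⁾(0)‖ ≤ 7! · K_res · 2(log A + log B) · 𝓛^{-16176} / 𝓛^{-7·2024}`. [folklore] -/
theorem norm_iteratedDeriv_hnum8_le (hχ : χ ^ 2 = 1) (hprim : χ.IsPrimitive) (hL : 3 ≤ Real.log D)
    (hLA : ‖χ.LFunction 1‖ ≤ 1 / Real.log D ^ 2022) (hA1 : 1 ≤ A) (hB1 : 1 ≤ B)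
    (hAL : Real.log A ≤ 8 * Real.log D) (hBL : Real.log B ≤ 8 * Real.log D) :
    ‖iteratedDeriv 7 (hnum8 χ A B) 0‖ ≤
      (Nat.factorial 7 : ℝ) * (Kres8 * (2 * (Real.log A + Real.log B)) / (Real.log D ^ 2022) ^ 8) /
        (1 / Real.log D ^ 2024) ^ 7 := by
  have hL1 : 1 ≤ Real.log D := by linarith
  have hD0 : D ≠ 0 := by
    rintro rfl; simp at hL; linarith
  have hq2 : 2 ≤ D := by
    rcases Nat.lt_or_ge D 2 with h | h
    · interval_cases D <;> norm_num at hL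
    · exact h
  have hχ1 := ne_one_of_isPrimitive χ hq2 hprim
  set r : ℝ := 1 / Real.log D ^ 2024 with hr
  have hr0 : 0 < r := by positivity
  have hL2 : (9 : ℝ) ≤ Real.log D ^ 2024 := by
    calc (9 : ℝ) = 3 ^ 2 := by norm_num
      _ ≤ Real.log D ^ 2 := pow_le_pow_left₀ (by norm_num) hL 2
      _ ≤ Real.log D ^ 2024 := pow_le_pow_right₀ hL1 (by norm_num)
  have hr9 : r ≤ 1 / 9 := div_le_div_of_nonneg_left (by norm_num) (by norm_num) hL2
  have hd : DiffContOnCl ℂ (hnum8 χ A B) (ball 0 r) := by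
    refine (differentiableOn_hnum8 χ hχ hχ1 (by linarith) (by linarith)).diffContOnCl_ball
      fun z hz => ?_
    rw [mem_closedBall, dist_zero_right] at hz
    simp only [mem_setOf_eq]
    have := Complex.abs_re_le_norm z
    have := neg_abs_le z.re
    linarith
  have hM : ∀ z ∈ sphere (0 : ℂ) r,
      ‖hnum8 χ A B z‖ ≤ Kres8 * (2 * (Real.log A + Real.log B)) / (Real.log D ^ 2022) ^ 8 := by
    intro z hz
    rw [mem_sphere, dist_zero_right] at hz
    exact norm_hnum8_le_sphere χ hχ hprim hL hLA hA1 hB1 hAL hBL hz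
  exact Complex.norm_iteratedDeriv_le_of_forall_mem_sphere_norm_le 7 hr0 hd hM

/-! ### §7. Elementary bookkeeping -/

omit [NeZero D] in
/-- `D^{-η} ≤ (2007/η)^{2007} 𝓛^{-2007}` for `η > 0` (`𝓛 = log D ≥ 1`; `log x ≤ x^ε/ε` with
`ε = η/2007`). [folklore] -/
theorem aux_rpow_logpow (hL : 1 ≤ Real.log D) (hD0 : (0 : ℝ) < D) {η : ℝ} (hη : 0 < η) :
    (D : ℝ) ^ (-η) ≤ (2007 / η) ^ 2007 / Real.log D ^ 2007 := by
  set Lg : ℝ := Real.log D with hLdef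
  have hL0 : 0 < Lg := by linarith
  have hε : 0 < η / 2007 := by positivity
  have h1 : Lg ≤ (D : ℝ) ^ (η / 2007) / (η / 2007) := Real.log_le_rpow_div hD0.le hε
  have h2 : Lg * (η / 2007) ≤ (D : ℝ) ^ (η / 2007) := by rwa [le_div_iff₀ hε] at h1
  have h3 : (Lg * (η / 2007)) ^ 2007 ≤ (D : ℝ) ^ η := by
    calc (Lg * (η / 2007)) ^ 2007 ≤ ((D : ℝ) ^ (η / 2007)) ^ 2007 :=
          pow_le_pow_left₀ (by positivity) h2 _
      _ = (D : ℝ) ^ η := by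
          rw [← Real.rpow_natCast, ← Real.rpow_mul hD0.le]
          congr 1; push_cast; ring
  have h4 : 0 < (Lg * (η / 2007)) ^ 2007 := by positivity
  rw [Real.rpow_neg hD0.le, inv_eq_one_div]
  calc 1 / (D : ℝ) ^ η ≤ 1 / (Lg * (η / 2007)) ^ 2007 := one_div_le_one_div_of_le h4 h3
    _ = (2007 / η) ^ 2007 / Lg ^ 2007 := by
        rw [mul_pow, div_pow, div_pow]
        field_simp

/-! ### §8. Lemma 3.2, conditional on its `L`-size input -/

/-- **Lemma 3.2 of the manuscript with the printed exponent, conditional on the `L`-size input,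
kernel-checked**: for every `κ < 1/8`, `b`, `C_L ≥ 0` there is a constant `C` such that for every
`D` with `log D ≥ 3`, every PRIMITIVE Dirichlet character `χ` mod `D` with `χ² = 1` satisfying
(A) `‖L(1,χ)‖ ≤ (log D)^{-2022}` AND `LBound χ κ b C_L` (`‖L(s,χ)‖ ≤ C_L D^κ (1+|im s|)^b` on
`re s = 3/4`), and every `N ≤ D⁸`, `∑_{D⁴ < n ≤ N} |ν(n)|² d(n)²/n ≤ C (log D)^{-2007}`
(`ν = 1 ∗ χ`, `d` = number of divisors). The hypothesis `LBound` is NOT discharged here or anywhere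
in the tree (convexity / Pólya–Vinogradov give only the excluded boundary `κ = 1/8`); the lemma's
consumer in the manuscript does not need it (`Section3Lemma36Input`). No claim about the manuscript's
theorems. [cite: Zhang2022LandauSiegel, §3, Lemma 3.2] -/
theorem lemma_3_2_conditional {κ : ℝ} (hκ : κ < 1 / 8) (b : ℕ) {CL : ℝ} (hCL : 0 ≤ CL) :
    ∃ C : ℝ, ∀ (D : ℕ) [NeZero D] (χ : DirichletCharacter ℂ D),
    χ.IsPrimitive → χ ^ 2 = 1 → 3 ≤ Real.log D →
    ‖χ.LFunction 1‖ ≤ 1 / Real.log D ^ 2022 → LBound χ κ b CL →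
    ∀ N : ℕ, (N : ℝ) ≤ (D : ℝ) ^ 8 →
      ∑ n ∈ Finset.Ioc (D ^ 4) N, ‖divisorSumChar χ n‖ ^ 2 * (n.divisors.card : ℝ) ^ 2 / n ≤
        C / Real.log D ^ 2007 := by
  have hδ : 0 < (1 - 8 * κ) / 12 := by linarith
  obtain ⟨Cd, hCd1, hCd⟩ := Sieve.exists_card_divisors_le_mul_rpow hδ
  set η : ℝ := (1 - 8 * κ) / 2 with hηdef
  have hη : 0 < η := by rw [hηdef]; linarith
  refine ⟨6 * (24 * Kres8 + Mline8 b * Kline8 * CL ^ 8 * Cd ^ 6 * 2 * (2007 / η) ^ 2007), ?_⟩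
  intro D _ χ hprim hχ2 hL hA hLB N hN
  set M : ℝ := (2007 / η : ℝ) ^ 2007 with hM
  clear_value M
  set Lg : ℝ := Real.log D with hLdef
  have hL1 : 1 ≤ Lg := by linarith
  have hL0 : 0 < Lg := by linarith
  have hD0 : D ≠ 0 := by
    rintro rfl; simp [hLdef] at hL; linarith
  have hDpos : (0 : ℝ) < D := by exact_mod_cast Nat.pos_of_ne_zero hD0
  have hD8 : 8 ≤ D := by
    have h1 : Real.exp 3 ≤ Real.exp Lg := Real.exp_le_exp.2 hL
    rw [hLdef, Real.exp_log hDpos] at h1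
    have := eight_lt_exp_three
    exact_mod_cast (show (8 : ℝ) ≤ D by linarith)
  have hχ1 := ne_one_of_isPrimitive χ (by omega) hprim
  obtain ⟨hApos, h4AB, hABsum, hA1, hB1, hlogA, hlogB⟩ := aux_AB (D := D) hL
  set A : ℝ := (D : ℝ) ^ 4 with hAdef
  set B : ℝ := (D : ℝ) ^ 8 with hBdef
  have hBpos : 0 < B := by linarith
  -- (1) smoothing
  have hS := sum_Ioc_tau_sq_le χ hχ2 hApos h4AB (M := D ^ 4) (N := N)
    (by rw [hAdef]; push_cast; exact le_rfl) hN
  -- (2) the contour shift across the pole of order eight at `z = 0`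
  set U : Set ℂ := {z : ℂ | -(1 / 2) < z.re} with hU
  have hUo : IsOpen U := isOpen_lt continuous_const Complex.continuous_re
  have hstrip := Literature.Analysis.Complex.integral_vertical_sub_eq_sum_of_poles
    (F := Fint8 χ A B) (σ₁ := -(1 / 4)) (κ := 2) (by norm_num) ({0} : Finset ℂ) (fun _ => 7)
    (fun _ => hnum8 χ A B) U hUo
    (fun z hz => by
      simp only [mem_preimage, mem_Icc] at hz
      show -(1 / 2) < z.re
      linarith [hz.1])
    (fun p hp => by rw [Finset.mem_singleton] at hp; rw [hp]; simp)
    (by rw [Finset.coe_singleton]; exact differentiableOn_Fint8 χ hχ2 hχ1 hApos hBpos)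
    (fun p hp => by
      rw [Finset.mem_singleton] at hp
      subst hp
      refine ⟨U, hUo.mem_nhds (by simp [hU]), differentiableOn_hnum8 χ hχ2 hχ1 hApos hBpos,
        fun z hz hz0 => ?_⟩
      refine Fint8_eq_hnum8_div χ hz0 fun m hm => ?_
      have hzre : -(1 / 2) < z.re := hz
      rw [hm] at hzre hz0
      simp at hzre
      have : m = 0 := by
        by_contra h
        have : (1 : ℝ) ≤ m := by exact_mod_cast Nat.one_le_iff_ne_zero.2 h
        linarith
      subst this
      simp at hz0)
    (integrable_Fint8_line χ hχ2 hχ1 hApos hBpos (Or.inr rfl))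
    (integrable_Fint8_line χ hχ2 hχ1 hApos hBpos (Or.inl rfl))
    (Fint8_horizontal_decay χ hχ2 hχ1 hApos hBpos)
  rw [Finset.sum_singleton] at hstrip
  -- the line `re z = 2`
  have h2 := (integral_Fint8_line_two χ hχ2 hApos hBpos).2
  have e2 : (∫ t : ℝ, Fint8 χ A B (((2 : ℝ) : ℂ) + t * I)) = ∫ t : ℝ, Fint8 χ A B (2 + t * I) := by
    norm_num
  rw [e2, h2] at hstrip
  -- so `2π (W(B) − W(A)) = 2π · h⁽⁷⁾(0)/7! + ∫_{re z = −1/4} F`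
  have hX : 2 * (π : ℂ) * (W (coeff8 χ) B - W (coeff8 χ) A) =
      2 * π * (iteratedDeriv 7 (hnum8 χ A B) 0 / ((Nat.factorial 7 : ℕ) : ℂ)) +
        ∫ t : ℝ, Fint8 χ A B ((((-(1 / 4) : ℝ)) : ℂ) + t * I) := sub_eq_iff_eq_add.1 hstrip
  have h2π : ‖(2 * (π : ℂ))‖ = 2 * π := by
    rw [norm_mul, Complex.norm_ofNat, Complex.norm_real, Real.norm_eq_abs, abs_of_pos Real.pi_pos]
  have hnormX : 2 * π * ‖W (coeff8 χ) B - W (coeff8 χ) A‖ ≤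
      2 * π * ‖iteratedDeriv 7 (hnum8 χ A B) 0 / ((Nat.factorial 7 : ℕ) : ℂ)‖ +
        ‖∫ t : ℝ, Fint8 χ A B ((((-(1 / 4) : ℝ)) : ℂ) + t * I)‖ := by
    have h := congrArg (fun w : ℂ => ‖w‖) hX
    simp only [norm_mul, h2π] at h
    rw [h]
    refine (norm_add_le _ _).trans (le_of_eq ?_)
    rw [norm_mul, h2π]
  have hΔn0 : ‖W (coeff8 χ) B - W (coeff8 χ) A‖ ≤
      ‖iteratedDeriv 7 (hnum8 χ A B) 0 / ((Nat.factorial 7 : ℕ) : ℂ)‖ +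
        ‖∫ t : ℝ, Fint8 χ A B ((((-(1 / 4) : ℝ)) : ℂ) + t * I)‖ := by
    have hπ3 := Real.pi_gt_three
    have hI0 := norm_nonneg (∫ t : ℝ, Fint8 χ A B ((((-(1 / 4) : ℝ)) : ℂ) + t * I))
    have h1 : ‖∫ t : ℝ, Fint8 χ A B ((((-(1 / 4) : ℝ)) : ℂ) + t * I)‖ ≤
        2 * π * ‖∫ t : ℝ, Fint8 χ A B ((((-(1 / 4) : ℝ)) : ℂ) + t * I)‖ := by nlinarith
    have h2 : 2 * π * ‖W (coeff8 χ) B - W (coeff8 χ) A‖ ≤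
        2 * π * (‖iteratedDeriv 7 (hnum8 χ A B) 0 / ((Nat.factorial 7 : ℕ) : ℂ)‖ +
          ‖∫ t : ℝ, Fint8 χ A B ((((-(1 / 4) : ℝ)) : ℂ) + t * I)‖) := by linarith
    exact le_of_mul_le_mul_left h2 (by positivity)
  -- (3) the residue term: `𝓛 · 𝓛^{-8·2022} · 𝓛^{7·2024} = 𝓛^{-2007}`
  have hres := norm_iteratedDeriv_hnum8_le χ hχ2 hprim hL hA hA1 hB1 hlogA hlogB
  have hfac : ((Nat.factorial 7 : ℕ) : ℝ) = 5040 := by norm_num [Nat.factorial]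
  have hT1 : ‖iteratedDeriv 7 (hnum8 χ A B) 0 / ((Nat.factorial 7 : ℕ) : ℂ)‖ ≤
      24 * Kres8 / Lg ^ 2007 := by
    rw [norm_div, Complex.norm_natCast, hfac]
    rw [hfac, ← hLdef] at hres
    have hK := Kres8_nonneg
    have hsum : Real.log A + Real.log B ≤ 12 * Lg := by
      rw [hAdef, hBdef, Real.log_pow, Real.log_pow, ← hLdef]; push_cast; linarith
    have step : 5040 * (Kres8 * (2 * (Real.log A + Real.log B)) / (Lg ^ 2022) ^ 8) / (1 / Lg ^ 2024) ^ 7 ≤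
        5040 * (Kres8 * (2 * (12 * Lg)) / (Lg ^ 2022) ^ 8) / (1 / Lg ^ 2024) ^ 7 := by
      gcongr
    have e : 5040 * (Kres8 * (2 * (12 * Lg)) / (Lg ^ 2022) ^ 8) / (1 / Lg ^ 2024) ^ 7 =
        5040 * (24 * Kres8 / Lg ^ 2007) := by
      have h16176 : (Lg ^ 2022) ^ 8 = Lg ^ 2007 * Lg * (Lg ^ 2024) ^ 7 := by
        rw [← pow_mul, ← pow_mul, ← pow_succ, ← pow_add]
      rw [h16176]
      field_simp
      ring
    rw [div_le_iff₀ (by norm_num : (0 : ℝ) < 5040)]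
    calc ‖iteratedDeriv 7 (hnum8 χ A B) 0‖
        ≤ 5040 * (Kres8 * (2 * (Real.log A + Real.log B)) / (Lg ^ 2022) ^ 8) / (1 / Lg ^ 2024) ^ 7 :=
          hres
      _ ≤ 5040 * (24 * Kres8 / Lg ^ 2007) := step.trans (le_of_eq e)
      _ = 24 * Kres8 / Lg ^ 2007 * 5040 := by ring
  -- (4) the shifted integral: `C_L⁸ D^{8κ} · (C_δ D^δ)⁶ · 2D^{-1} = 2 C_L⁸ C_δ⁶ D^{-η}`,
  --     `δ = (1−8κ)/12`, `η = (1−8κ)/2 > 0`, and `D^{-η} ≤ (2007/η)^{2007} 𝓛^{-2007}`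
  have hT2 : ‖∫ t : ℝ, Fint8 χ A B ((((-(1 / 4) : ℝ)) : ℂ) + t * I)‖ ≤
      Mline8 b * Kline8 * CL ^ 8 * Cd ^ 6 * 2 * M / Lg ^ 2007 := by
    have hI := norm_integral_Fint8_line_le χ hχ2 hD0 hCL hLB hApos hBpos
    have hτ : (D.divisors.card : ℝ) ≤ Cd * (D : ℝ) ^ ((1 - 8 * κ) / 12) := hCd D hD0
    have e8 : ((D : ℝ) ^ κ) ^ 8 = (D : ℝ) ^ (κ * 8) := by
      rw [← Real.rpow_natCast, ← Real.rpow_mul hDpos.le]; norm_num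
    have e6 : ((D : ℝ) ^ ((1 - 8 * κ) / 12)) ^ 6 = (D : ℝ) ^ ((1 - 8 * κ) / 12 * 6) := by
      rw [← Real.rpow_natCast, ← Real.rpow_mul hDpos.le]; norm_num
    have e1 : (2 : ℝ) / D = 2 * (D : ℝ) ^ (-1 : ℝ) := by
      rw [Real.rpow_neg_one]; ring
    have hrp : ((D : ℝ) ^ κ) ^ 8 * ((D : ℝ) ^ ((1 - 8 * κ) / 12)) ^ 6 * (2 / D) =
        2 * (D : ℝ) ^ (-η) := by
      rw [e8, e6, e1, show -η = κ * 8 + (1 - 8 * κ) / 12 * 6 + (-1) by rw [hηdef]; ring,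
        Real.rpow_add hDpos, Real.rpow_add hDpos]
      ring
    have hlp := aux_rpow_logpow (D := D) hL1 hDpos hη
    rw [← hLdef, ← hM] at hlp
    have hKl := Kline8_pos
    have hMl := Mline8_nonneg b
    have hCd0 : 0 ≤ Cd := by linarith
    have hmain : Kline8 * (CL * (D : ℝ) ^ κ) ^ 8 * (D.divisors.card : ℝ) ^ 6 *
        (A ^ (-(1 / 4) : ℝ) + B ^ (-(1 / 4) : ℝ)) ≤
        Kline8 * CL ^ 8 * Cd ^ 6 * 2 * (M / Lg ^ 2007) := by
      calc Kline8 * (CL * (D : ℝ) ^ κ) ^ 8 * (D.divisors.card : ℝ) ^ 6 *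
            (A ^ (-(1 / 4) : ℝ) + B ^ (-(1 / 4) : ℝ))
          ≤ Kline8 * (CL * (D : ℝ) ^ κ) ^ 8 * (Cd * (D : ℝ) ^ ((1 - 8 * κ) / 12)) ^ 6 * (2 / D) := by
            gcongr
        _ = Kline8 * CL ^ 8 * Cd ^ 6 *
              (((D : ℝ) ^ κ) ^ 8 * ((D : ℝ) ^ ((1 - 8 * κ) / 12)) ^ 6 * (2 / D)) := by ring
        _ = Kline8 * CL ^ 8 * Cd ^ 6 * (2 * (D : ℝ) ^ (-η)) := by rw [hrp]
        _ ≤ Kline8 * CL ^ 8 * Cd ^ 6 * (2 * (M / Lg ^ 2007)) := by gcongr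
        _ = Kline8 * CL ^ 8 * Cd ^ 6 * 2 * (M / Lg ^ 2007) := by ring
    calc ‖∫ t : ℝ, Fint8 χ A B ((((-(1 / 4) : ℝ)) : ℂ) + t * I)‖
        ≤ Mline8 b * (Kline8 * (CL * (D : ℝ) ^ κ) ^ 8 * (D.divisors.card : ℝ) ^ 6 *
            (A ^ (-(1 / 4) : ℝ) + B ^ (-(1 / 4) : ℝ))) := hI
      _ ≤ Mline8 b * (Kline8 * CL ^ 8 * Cd ^ 6 * 2 * (M / Lg ^ 2007)) := by gcongr
      _ = Mline8 b * Kline8 * CL ^ 8 * Cd ^ 6 * 2 * M / Lg ^ 2007 := by ring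
  -- (5) combine
  have hΔn : ‖W (coeff8 χ) B - W (coeff8 χ) A‖ ≤
      (24 * Kres8 + Mline8 b * Kline8 * CL ^ 8 * Cd ^ 6 * 2 * M) / Lg ^ 2007 := by
    refine hΔn0.trans ?_
    rw [add_div]
    exact add_le_add hT1 hT2
  calc ∑ n ∈ Finset.Ioc (D ^ 4) N, ‖divisorSumChar χ n‖ ^ 2 * (n.divisors.card : ℝ) ^ 2 / n
      ≤ 6 * (W (coeff8 χ) B - W (coeff8 χ) A).re := hS
    _ ≤ 6 * ‖W (coeff8 χ) B - W (coeff8 χ) A‖ := by gcongr; exact Complex.re_le_norm _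
    _ ≤ 6 * ((24 * Kres8 + Mline8 b * Kline8 * CL ^ 8 * Cd ^ 6 * 2 * M) / Lg ^ 2007) := by gcongr
    _ = _ := by rw [hLdef]; ring

end Literature.NumberTheory.LFunctions.Zhang2022.Lemma32Cond

end
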